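import Summits.NavierStokesRegularity.NavierStokesRegularity.Theorems.ExtremiserTransienceNearExtremalTransienceExtremiserLiouvilleConstantSpeedSlabRateJet
import Summits.NavierStokesRegularity.NavierStokesRegularity.Theorems.ExtremiserTransienceNearExtremalTransienceExtremiserLiouvilleConstantSpeedTailCutoff
import HarnessLib

/-!
# Crux `ExtremiserTransience.NearExtremalTransience` (stmt-NavierStokesRegularity-21883), line `extremiser_liouville`,
# stub K1b — TOOLS FOR THE RADIAL TAIL LAW: ball energies of the jet and the two weighted energies of the annular cut-off

`--supports stmt-NavierStokesRegularity-21883` (helper).  Author: prover seat `ns-el-k1b` (g7).  The far-field Caccioppoli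
inequality (`…CrossTermsAssembly.farCaccioppoli_weighted`) tested with the radial annular cut-off `(1 − χ_R)χ_{R′}`
(`…ConstantSpeedTailCutoff`), the generic Leray corrector (`…LerayCorrector.lerayCorrector_bounds`, radius `1`:
`η ≤ 4MK/R + √(∫(Dθ V)²/4π) = O(R^{-1/2})`) and the ball energies of the jet (`∫_{B_ρ}‖V‖² ≤ 5E₀ρ`, g6):

* `integral_indicator_ball_sq_le` — real-valued ball energy of the jet: `∫_{B_ρ}‖v − c‖² ≤ 5E₀ρ`;
* `radialCutoff_weighted_energies` — for the annular cut-off `θ = (1−χ_R)χ_{R′}` (`1 ≤ R`, `4R ≤ R′`) with the weights of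
  `…TailCutoff.exists_radialCutoff_weights`: `∫‖D∇θ‖‖V‖² ≤ 19KE₀/R` and `∫(Dθ V)² ≤ 19K²E₀/R` (the derivatives vanish off
  `B_{3R′}`, ball energies `≤ 15E₀R`, `15E₀R′`).
The tail law itself is `…ConstantSpeedTailLaw.tailLaw_jet`.

WHAT THIS IS NOT: K1b is NOT proved; nothing here proves NS regularity. [folklore]
-/

noncomputable section

open Set Filter Topology MeasureTheory Metric Function Real Bornology
open scoped ENNReal NNReal Topology InnerProductSpace RealInnerProductSpace ContDiff

namespace Summit.NavierStokesRegularity.NavierStokesRegularity.Theorems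

-- the problem directory repeats the summit name (`NavierStokesRegularity/NavierStokesRegularity`)
set_option linter.dupNamespace false

namespace ExtremiserLiouville

open Literature.Analysis.FluidPDE Literature.Analysis
open DepletionLadder.KStar DepletionLadder.KStar.HalfSpace

variable {v : E3 → E3} {c : E3}

/-- **Ball energies of the jet, real-valued**: `∫_{B_ρ}‖v − c‖² ≤ 5E₀ρ` (`ρ ≥ 1`). [folklore] -/
theorem integral_indicator_ball_sq_le (hv : ContDiff ℝ ∞ v) (hdiv : VectorCalculus.IsDivFree v) {M : ℝ}
    (hM : ∀ x, ‖v x‖ = M) (hcM : ‖c‖ = M) (hc0 : c 0 = 0) (hc1 : c 1 = 0) (hc2 : c 2 ≠ 0)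
    (hslab : ∀ T : ℝ, 0 < T → Integrable (fun x => {x : E3 | |x 2| ≤ T}.indicator (fun x => ‖v x - c‖ ^ 2) x) volume)
    {E₀ : ℝ} (hE0 : 0 ≤ E₀) (hE : ∀ s : ℝ, (∫ x, deriv Real.smoothTransition (x 2 - s) * ‖v x - c‖ ^ 2) = E₀)
    {ρ : ℝ} (hρ : 1 ≤ ρ) :
    (∫ x, (ball (0 : E3) ρ).indicator (fun x => ‖v x - c‖ ^ 2) x) ≤ 5 * E₀ * ρ := by
  have hl := lintegral_ball_excess_sq_le_of_jet (hv.of_le (by norm_cast)) hdiv hM hcM hc0 hc1 hc2 hslab hE0 hE hρ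
  have cV : Continuous fun x => v x - c := (hv.sub contDiff_const).continuous
  rw [integral_indicator measurableSet_ball,
    integral_eq_lintegral_of_nonneg_ae (Eventually.of_forall fun x => sq_nonneg _) ((cV.norm.pow 2).aestronglyMeasurable.restrict)]
  refine ENNReal.toReal_le_of_le_ofReal (by positivity) ?_
  refine le_trans (le_of_eq (lintegral_congr fun x => ?_)) hl
  rw [← ofReal_norm, ← ENNReal.ofReal_pow (norm_nonneg _)]


/-- **The two weighted energies of the annular cut-off on the jet.**  For `θ = (1 − χ_R)χ_{R′}` (`1 ≤ R`, `4R ≤ R′`) whose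
derivative weights are `‖Dθ‖ ≤ (K/R)𝟙_{‖x‖≤2R} + (K/R′)𝟙_{R′≤‖x‖}`, `‖D∇θ‖ ≤ (K/R²)𝟙 + (K/R′²)𝟙`:
`∫‖D∇θ‖‖v − c‖² ≤ 19KE₀/R` and `∫(Dθ(v − c))² ≤ 19K²E₀/R`. [folklore] -/
theorem radialCutoff_weighted_energies (hv : ContDiff ℝ ∞ v) (hdiv : VectorCalculus.IsDivFree v) {M : ℝ}
    (hM : ∀ x, ‖v x‖ = M) (hcM : ‖c‖ = M) (hc0 : c 0 = 0) (hc1 : c 1 = 0) (hc2 : c 2 ≠ 0)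
    (hslab : ∀ T : ℝ, 0 < T → Integrable (fun x => {x : E3 | |x 2| ≤ T}.indicator (fun x => ‖v x - c‖ ^ 2) x) volume)
    {E₀ : ℝ} (hE0 : 0 ≤ E₀) (hE : ∀ s : ℝ, (∫ x, deriv Real.smoothTransition (x 2 - s) * ‖v x - c‖ ^ 2) = E₀)
    {K R R' : ℝ} (hK0 : 0 < K) (hR1 : 1 ≤ R) (hRR' : 4 * R ≤ R')
    (hKx : ∀ x : E3,
      ‖fderiv ℝ (fun x : E3 => (1 - cutoff R x) * cutoff R' x) x‖ ≤
          K / R * (closedBall (0 : E3) (2 * R)).indicator (fun _ => (1 : ℝ)) x +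
            K / R' * (ball (0 : E3) R')ᶜ.indicator (fun _ => (1 : ℝ)) x ∧
      ‖fderiv ℝ (gradient (fun x : E3 => (1 - cutoff R x) * cutoff R' x)) x‖ ≤
          K / R ^ 2 * (closedBall (0 : E3) (2 * R)).indicator (fun _ => (1 : ℝ)) x +
            K / R' ^ 2 * (ball (0 : E3) R')ᶜ.indicator (fun _ => (1 : ℝ)) x) :
    (∫ x, ‖fderiv ℝ (gradient (fun x : E3 => (1 - cutoff R x) * cutoff R' x)) x‖ * ‖v x - c‖ ^ 2) ≤ 19 * K * E₀ / R ∧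
    (∫ x, (fderiv ℝ (fun x : E3 => (1 - cutoff R x) * cutoff R' x) x (v x - c)) ^ 2) ≤ 19 * K ^ 2 * E₀ / R := by
  have hR0 : 0 < R := one_pos.trans_le hR1
  have hR'0 : 0 < R' := by linarith
  set θ : E3 → ℝ := fun x : E3 => (1 - cutoff R x) * cutoff R' x with hθdef
  have hθ : ContDiff ℝ ∞ θ := contDiff_radialCutoff R R'
  have hθc : HasCompactSupport θ := hasCompactSupport_radialCutoff R hR'0
  have hV : ContDiff ℝ ∞ (fun y => v y - c) := hv.sub contDiff_const
  have cV : Continuous (fun y => v y - c) := hV.continuous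
  have hind_le : ∀ x, (closedBall (0 : E3) (2 * R)).indicator (fun _ => (1 : ℝ)) x ≤ 1 ∧
      (ball (0 : E3) R')ᶜ.indicator (fun _ => (1 : ℝ)) x ≤ 1 := fun x =>
    ⟨indicator_le_self' (fun _ _ => zero_le_one) x, indicator_le_self' (fun _ _ => zero_le_one) x⟩
  -- ball energies
  have hball : ∀ ρ : ℝ, 1 ≤ ρ → (∫ x, (ball (0 : E3) ρ).indicator (fun x => ‖v x - c‖ ^ 2) x) ≤ 5 * E₀ * ρ := fun ρ hρ =>
    integral_indicator_ball_sq_le hv hdiv hM hcM hc0 hc1 hc2 hslab hE0 hE hρ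
  have iball : ∀ ρ : ℝ, Integrable (fun x => (ball (0 : E3) ρ).indicator (fun x => ‖v x - c‖ ^ 2) x) volume := fun ρ =>
    (integrable_indicator_iff measurableSet_ball).2
      (((cV.norm.pow 2).continuousOn.integrableOn_compact (isCompact_closedBall (0 : E3) ρ)).mono_set ball_subset_closedBall)
  -- the derivatives vanish off `B_{3R′}`
  have hzero : ∀ x, 3 * R' ≤ ‖x‖ → fderiv ℝ θ x = 0 ∧ fderiv ℝ (gradient θ) x = 0 := by
    intro x hx
    have hxt : x ∉ tsupport θ := fun h => by
      have h' : x ∈ tsupport (cutoff (E := E3) R') :=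
        (tsupport_mul_subset_right (f := fun x : E3 => 1 - cutoff R x) (g := cutoff R')) h
      have := tsupport_cutoff_subset hR'0 h'
      rw [mem_closedBall, dist_zero_right] at this; linarith
    refine ⟨fderiv_of_notMem_tsupport ℝ hxt, fderiv_of_notMem_tsupport ℝ fun h => hxt ?_⟩
    exact (tsupport_fderiv_subset ℝ) ((tsupport_comp_subset (g := (InnerProductSpace.toDual ℝ E3).symm) (map_zero _) _) h)
  have h3R : 1 ≤ 3 * R := by linarith
  have h3R' : 1 ≤ 3 * R' := by linarith
  have htail : 15 * K * E₀ / R + 15 * K * E₀ / R' ≤ 19 * K * E₀ / R := by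
    have h4 : 15 * K * E₀ / R' ≤ 4 * K * E₀ / R := by
      rw [div_le_div_iff₀ hR'0 hR0]
      have h0 : 0 ≤ K * E₀ * R := mul_nonneg (mul_nonneg hK0.le hE0) hR0.le
      have h5 := mul_le_mul_of_nonneg_left hRR' (by positivity : (0:ℝ) ≤ 4 * K * E₀)
      linarith
    have e : 19 * K * E₀ / R = 15 * K * E₀ / R + 4 * K * E₀ / R := by ring
    rw [e]; linarith
  constructor
  · -- `∫‖D∇θ‖‖V‖²`
    have hwV : ∀ x, ‖fderiv ℝ (gradient θ) x‖ * ‖v x - c‖ ^ 2 ≤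
        K / R ^ 2 * ((ball (0 : E3) (3 * R)).indicator (fun x => ‖v x - c‖ ^ 2) x) +
          K / R' ^ 2 * ((ball (0 : E3) (3 * R')).indicator (fun x => ‖v x - c‖ ^ 2) x) := by
      intro x
      have hnn1 : 0 ≤ K / R ^ 2 * (ball (0 : E3) (3 * R)).indicator (fun x => ‖v x - c‖ ^ 2) x :=
        mul_nonneg (by positivity) (indicator_nonneg (fun _ _ => sq_nonneg _) _)
      have hnn2 : 0 ≤ K / R' ^ 2 * (ball (0 : E3) (3 * R')).indicator (fun x => ‖v x - c‖ ^ 2) x :=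
        mul_nonneg (by positivity) (indicator_nonneg (fun _ _ => sq_nonneg _) _)
      by_cases hx3 : 3 * R' ≤ ‖x‖
      · rw [(hzero x hx3).2, norm_zero, zero_mul]; exact add_nonneg hnn1 hnn2
      · have hx3' : x ∈ ball (0 : E3) (3 * R') := mem_ball_zero_iff.2 (not_le.1 hx3)
        rw [indicator_of_mem hx3']
        have h := (hKx x).2
        have hi := hind_le x
        by_cases hx2 : ‖x‖ ≤ 2 * R
        · have hxin : x ∈ ball (0 : E3) (3 * R) := mem_ball_zero_iff.2 (by linarith)
          rw [indicator_of_mem hxin]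
          calc ‖fderiv ℝ (gradient θ) x‖ * ‖v x - c‖ ^ 2 ≤ (K / R ^ 2 * 1 + K / R' ^ 2 * 1) * ‖v x - c‖ ^ 2 := by
                refine mul_le_mul_of_nonneg_right (h.trans ?_) (sq_nonneg _)
                gcongr
                · exact hi.1
                · exact hi.2
            _ = _ := by ring
        · have hnot : x ∉ closedBall (0 : E3) (2 * R) := fun h' => hx2 (mem_closedBall_zero_iff.1 h')
          rw [indicator_of_notMem hnot, mul_zero, zero_add] at h
          calc ‖fderiv ℝ (gradient θ) x‖ * ‖v x - c‖ ^ 2 ≤ (K / R' ^ 2 * 1) * ‖v x - c‖ ^ 2 := by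
                refine mul_le_mul_of_nonneg_right (h.trans ?_) (sq_nonneg _)
                gcongr; exact hi.2
            _ ≤ _ := by linarith [hnn1]
    have cDg : Continuous (fderiv ℝ (gradient θ)) := (contDiff_gradient_top hθ).continuous_fderiv (by simp)
    have hDgc : HasCompactSupport (fderiv ℝ (gradient θ)) := (hasCompactSupport_gradient hθc).fderiv (𝕜 := ℝ)
    have i3 : Integrable (fun x => ‖fderiv ℝ (gradient θ) x‖ * ‖v x - c‖ ^ 2) volume :=
      (cDg.norm.mul (cV.norm.pow 2)).integrable_of_hasCompactSupport hDgc.norm.mul_right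
    calc (∫ x, ‖fderiv ℝ (gradient θ) x‖ * ‖v x - c‖ ^ 2)
        ≤ ∫ x, (K / R ^ 2 * ((ball (0 : E3) (3 * R)).indicator (fun x => ‖v x - c‖ ^ 2) x) +
            K / R' ^ 2 * ((ball (0 : E3) (3 * R')).indicator (fun x => ‖v x - c‖ ^ 2) x)) :=
          integral_mono i3 (((iball _).const_mul _).add ((iball _).const_mul _)) hwV
      _ = K / R ^ 2 * (∫ x, (ball (0 : E3) (3 * R)).indicator (fun x => ‖v x - c‖ ^ 2) x) +
            K / R' ^ 2 * (∫ x, (ball (0 : E3) (3 * R')).indicator (fun x => ‖v x - c‖ ^ 2) x) := by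
          rw [integral_add ((iball _).const_mul _) ((iball _).const_mul _), integral_const_mul, integral_const_mul]
      _ ≤ K / R ^ 2 * (5 * E₀ * (3 * R)) + K / R' ^ 2 * (5 * E₀ * (3 * R')) :=
          add_le_add (mul_le_mul_of_nonneg_left (hball _ h3R) (by positivity))
            (mul_le_mul_of_nonneg_left (hball _ h3R') (by positivity))
      _ = 15 * K * E₀ / R + 15 * K * E₀ / R' := by field_simp; ring
      _ ≤ 19 * K * E₀ / R := htail
  · -- `∫ (Dθ V)²`
    have hwD : ∀ x, (fderiv ℝ θ x (v x - c)) ^ 2 ≤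
        (K / R) ^ 2 * ((ball (0 : E3) (3 * R)).indicator (fun x => ‖v x - c‖ ^ 2) x) +
          (K / R') ^ 2 * ((ball (0 : E3) (3 * R')).indicator (fun x => ‖v x - c‖ ^ 2) x) := by
      intro x
      have hi := hind_le x
      have hnn1 : 0 ≤ (K / R) ^ 2 * (ball (0 : E3) (3 * R)).indicator (fun x => ‖v x - c‖ ^ 2) x :=
        mul_nonneg (sq_nonneg _) (indicator_nonneg (fun _ _ => sq_nonneg _) _)
      have hnn2 : 0 ≤ (K / R') ^ 2 * (ball (0 : E3) (3 * R')).indicator (fun x => ‖v x - c‖ ^ 2) x :=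
        mul_nonneg (sq_nonneg _) (indicator_nonneg (fun _ _ => sq_nonneg _) _)
      by_cases hx3 : 3 * R' ≤ ‖x‖
      · rw [(hzero x hx3).1, _root_.zero_apply]
        simp only [ne_eq, OfNat.ofNat_ne_zero, not_false_eq_true, zero_pow]
        exact add_nonneg hnn1 hnn2
      · have hx3' : x ∈ ball (0 : E3) (3 * R') := mem_ball_zero_iff.2 (not_le.1 hx3)
        have hsq : (fderiv ℝ θ x (v x - c)) ^ 2 ≤ (‖fderiv ℝ θ x‖ * ‖v x - c‖) ^ 2 := by
          rw [← sq_abs]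
          exact pow_le_pow_left₀ (abs_nonneg _) (by rw [← Real.norm_eq_abs]; exact (fderiv ℝ θ x).le_opNorm _) 2
        have h := (hKx x).1
        by_cases hx2 : ‖x‖ ≤ 2 * R
        · have hxin : x ∈ ball (0 : E3) (3 * R) := mem_ball_zero_iff.2 (by linarith)
          have hout : x ∉ (ball (0 : E3) R')ᶜ := fun h' => by
            rw [mem_compl_iff, mem_ball_zero_iff, not_lt] at h'; linarith
          rw [indicator_of_notMem hout, mul_zero, add_zero] at h
          rw [indicator_of_mem hxin]
          calc (fderiv ℝ θ x (v x - c)) ^ 2 ≤ (‖fderiv ℝ θ x‖ * ‖v x - c‖) ^ 2 := hsq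
            _ ≤ (K / R * 1 * ‖v x - c‖) ^ 2 := by
                refine pow_le_pow_left₀ (by positivity) (mul_le_mul_of_nonneg_right (h.trans ?_) (norm_nonneg _)) 2
                gcongr; exact hi.1
            _ = (K / R) ^ 2 * ‖v x - c‖ ^ 2 := by ring
            _ ≤ _ := by linarith [hnn2]
        · have hnot : x ∉ closedBall (0 : E3) (2 * R) := fun h' => hx2 (mem_closedBall_zero_iff.1 h')
          rw [indicator_of_notMem hnot, mul_zero, zero_add] at h
          rw [indicator_of_mem hx3']
          calc (fderiv ℝ θ x (v x - c)) ^ 2 ≤ (‖fderiv ℝ θ x‖ * ‖v x - c‖) ^ 2 := hsq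
            _ ≤ (K / R' * 1 * ‖v x - c‖) ^ 2 := by
                refine pow_le_pow_left₀ (by positivity) (mul_le_mul_of_nonneg_right (h.trans ?_) (norm_nonneg _)) 2
                gcongr; exact hi.2
            _ = (K / R') ^ 2 * ‖v x - c‖ ^ 2 := by ring
            _ ≤ _ := by linarith [hnn1]
    calc (∫ x, (fderiv ℝ θ x (v x - c)) ^ 2)
        ≤ ∫ x, ((K / R) ^ 2 * ((ball (0 : E3) (3 * R)).indicator (fun x => ‖v x - c‖ ^ 2) x) +
            (K / R') ^ 2 * ((ball (0 : E3) (3 * R')).indicator (fun x => ‖v x - c‖ ^ 2) x)) :=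
          integral_mono_of_nonneg (Eventually.of_forall fun x => sq_nonneg _)
            (((iball _).const_mul _).add ((iball _).const_mul _)) (Eventually.of_forall hwD)
      _ = (K / R) ^ 2 * (∫ x, (ball (0 : E3) (3 * R)).indicator (fun x => ‖v x - c‖ ^ 2) x) +
            (K / R') ^ 2 * (∫ x, (ball (0 : E3) (3 * R')).indicator (fun x => ‖v x - c‖ ^ 2) x) := by
          rw [integral_add ((iball _).const_mul _) ((iball _).const_mul _), integral_const_mul, integral_const_mul]
      _ ≤ (K / R) ^ 2 * (5 * E₀ * (3 * R)) + (K / R') ^ 2 * (5 * E₀ * (3 * R')) :=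
          add_le_add (mul_le_mul_of_nonneg_left (hball _ h3R) (sq_nonneg _))
            (mul_le_mul_of_nonneg_left (hball _ h3R') (sq_nonneg _))
      _ = 15 * (K * K) * E₀ / R + 15 * (K * K) * E₀ / R' := by field_simp; ring
      _ ≤ 19 * K ^ 2 * E₀ / R := by
          have hK2 : 0 < K * K := mul_pos hK0 hK0
          have h4 : 15 * (K * K) * E₀ / R' ≤ 4 * (K * K) * E₀ / R := by
            rw [div_le_div_iff₀ hR'0 hR0]
            have h0 : 0 ≤ K * K * E₀ * R := mul_nonneg (mul_nonneg hK2.le hE0) hR0.le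
            have h5 := mul_le_mul_of_nonneg_left hRR' (by positivity : (0:ℝ) ≤ 4 * (K * K) * E₀)
            linarith
          have e : 19 * K ^ 2 * E₀ / R = 15 * (K * K) * E₀ / R + 4 * (K * K) * E₀ / R := by ring
          rw [e]; linarith

end ExtremiserLiouville

end Summit.NavierStokesRegularity.NavierStokesRegularity.Theorems

end
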